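import Summits.BirchSwinnertonDyer.Rank1Residual.Additive.GordRatMainConjLowerBoundOdd
import Summits.BirchSwinnertonDyer.Rank1Residual.Additive.ChiBranchLowerInput
import Summits.BirchSwinnertonDyer.Rank1Residual.Additive.ChiBranchLowerInputOdd
import HarnessLib

/-!
# The rational branch main conjecture + ONE unit coefficient already give the INTEGRAL branch-level
# containment `char ⊆ (ϖ·L_p-branch)·Λ` (cell `b2b-bsdres`, team n1011, seat n1011-p06, OWNERS row
# T-N10R, phase 4: bridges to n1011-p07's typed lower inputs)

HONEST FRAMING (cell `b2b-bsdres`, run/shared/lean/b2b/bsd-rank1-residual/, verbatim in every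
file): the goal of the cell is to DELETE the COMBINATION-SHAPED residual classes of the
Birch–Swinnerton-Dyer formula for ALL analytic-rank `≤ 1` elliptic curves over `ℚ` — "full BSD
formula for every rank `≤ 1` curve in class `C`" assembled STRICTLY from published theorems — so
that the rank-`≤ 1` remainder becomes exactly the CONSTRUCTION-SHAPED classes, which are TYPED
(missing-input `Prop`s), NOT attempted. This is not "finishing BSD". Team n1011 (X4 ∧ `p = 3` / the
additive block, §I items N10 / N11): research routes; prove what is provable now; no claim beyond
the stated classes; X4♯(G-ord) stays CONSTRUCTION-SHAPED; labels / census / located gap UNCHANGED;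
nothing is booked. Theorems only; no definition, no named fact.

## What and why

Team n1011 now has THREE typed forms of the missing LOWER (Eisenstein) input on the
semistable-twist locus, in decreasing strength:
(1) n1011-p07's branch-level INTEGRAL containment `ChiBranchLowerDivisibility[Odd]At W p`
    (`ChiBranchLowerInput[Odd].lean`: every `g ∈ char_Λ X(E/ℚ_∞)` is `ι h · ϖ · L_p(f♭, α, ω^{(p−1)/2}, T)`
    for some `h ∈ Λ`);
(2) the `T = 0` integral divisibility `CycLowerLeadingTermAt W p` (additive-p2) ≡ `CycLeadingTermDvdAt W p`
    (n1011-p18) (`CycLowerInputsBridge.lean`, this seat);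
(3) this seat's RATIONAL equality `ChiBranchRatCharEq[Odd]At W p` + a per-pair unit-coefficient
    certificate (`GordRatMainConjLowerBound[Odd].lean`).
Phases 1–2 proved (3) ⟹ (2). This file proves (3) ⟹ (1): if `char = (g₀)` with
`ι g₀ = p^k · ϖ · L_br` and SOME coefficient of `ϖ · L_br` is a unit, then `k ≥ 0`
(`X9.exponent_nonneg_of_exists_norm_coeff_eq_one` — `ι g₀` has `ℤ_p`-coefficients) and every
`g = a · g₀ ∈ char` is `ι(a · p^k) · ϖ · L_br`. So the weakest input of the three, the one a
Skinner–Urban-type theorem would print ("`Ch = (𝓛)` in `Λ ⊗ ℚ_p`"), already delivers the strongest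
integral form once the certificate is in hand; all of p07's transport consequences
(`ChiBranchLowerTransport.lean`) then apply.

* `chiBranchLowerDivisibilityAt_of_ratCharEq_of_unitCoeff` (`p ≡ 1 (mod 4)`, good-ordinary twist);
* `chiBranchLowerDivisibilityOddAt_of_ratCharEqOdd_of_unitCoeff` (`p ≡ 3 (mod 4)`, `p = 3` included);
* `chiBranchLowerLeadingTerm[Odd]At_of_ratCharEq[Odd]_of_unitCoeff_of_padicValRat_j_nonneg` — the
  `T = 0` forms through p07's `…_of_divisibility[Odd]_of_padicValRat_j_nonneg` on the potentially good
  rows (`0 ≤ ord_p j`).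

Located gap unchanged: the Eisenstein divisibility of the branch main conjecture, rationally.
Nothing booked.

References: Burungale–Castella–Skinner, IMRN 2025 Thm. 1.1.2 (a) [BurungaleCastellaSkinner2025];
Skinner–Urban, Invent. Math. 195 (2014) Thm. 3.6.4 [SkinnerUrban2014]; Greenberg, LNM 1716 (1999) §5
[GreenbergLNM1716].
-/

noncomputable section

open scoped Classical MatrixGroups ModularForm NumberField

open CongruenceSubgroup WeierstrassCurve NumberField Literature.NumberTheory.EllipticCurves
  Literature.NumberTheory.EllipticCurves.ModularForms
  Literature.NumberTheory.EllipticCurves.Rank1Residual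
  Literature.NumberTheory.EllipticCurves.Rank1Residual.Typed
  IsDedekindDomain

namespace Summit.BirchSwinnertonDyer.Rank1Residual.Additive

/-- The algebra of the bridge: from `char = (g₀)`, `ι g₀ = C(p^k · c) · L` with `0 ≤ k` and
`g ∈ char`, produce `h ∈ Λ` with `ι g = ι h · (C c · L)` (`h = a · p^k` where `g = a · g₀`). [folklore] -/
theorem exists_iwasawaToPowerSeries_eq_mul_of_span_eq_of_nonneg {W : WeierstrassCurve ℚ} {p : ℕ}
    [Fact p.Prime] {κ : ZpExtension ℚ p}
    {γ : Field.absoluteGaloisGroup ℚ} (D : W.SelmerDualData κ γ) {g₀ g : IwasawaAlgebra p}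
    (hchar : D.charIdeal = Ideal.span {g₀}) (hg : g ∈ D.charIdeal) {k : ℤ} (hk : 0 ≤ k)
    {c : ℚ_[p]} {L : PowerSeries ℚ_[p]}
    (hι : iwasawaToPowerSeries p g₀ = PowerSeries.C ((p : ℚ_[p]) ^ k * c) * L) :
    ∃ h : IwasawaAlgebra p,
      iwasawaToPowerSeries p g = iwasawaToPowerSeries p h * (PowerSeries.C c * L) := by
  obtain ⟨m, rfl⟩ : ∃ m : ℕ, k = m := ⟨k.toNat, (Int.toNat_of_nonneg hk).symm⟩
  have hg' : g ∈ Ideal.span ({g₀} : Set (IwasawaAlgebra p)) := by rwa [hchar] at hg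
  obtain ⟨a, rfl⟩ := Ideal.mem_span_singleton'.mp hg'
  refine ⟨a * PowerSeries.C ((p : ℤ_[p]) ^ m), ?_⟩
  rw [map_mul, map_mul, hι, zpow_natCast, PowerSeries.map_C, map_pow, map_natCast, map_mul]
  ring

/-- **`p ≡ 1 (mod 4)`: the rational branch main conjecture + ONE unit coefficient ⟹ n1011-p07's
INTEGRAL branch containment `ChiBranchLowerDivisibilityAt W p`.** For every good-ordinary twist datum
(`V`, `f`, `ϖ`) the certificate `hcert` supplies a unit coefficient of `ϖ · L_p(f, α, ω^{(p−1)/2}, T)`;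
then `char = (g₀)`, `ι g₀ = p^k ϖ L_br` (`ChiBranchRatCharEqAt`) has `k ≥ 0`
(`X9.exponent_nonneg_of_exists_norm_coeff_eq_one`: `ι g₀ ∈ ℤ_p⟦T⟧`) and every `g ∈ char` is
`ι(a · p^k) · ϖ L_br`. [cite: BurungaleCastellaSkinner2025, Thm. 1.1.2 (a) (shape)]
[cite: SkinnerUrban2014, Thm. 3.6.4 (p. 43) (shape)] -/
theorem chiBranchLowerDivisibilityAt_of_ratCharEq_of_unitCoeff (W : WeierstrassCurve ℚ) (p : ℕ)
    [Fact p.Prime] (hMC : ChiBranchRatCharEqAt W p)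
    (hcert : ∀ (V : WeierstrassCurve ℚ) [V.IsElliptic] [V.IsGloballyMinimal] (C : VariableChange ℚ),
      GoodOrd V p → C • V.quadraticTwist (p : ℚ) = W →
      ∀ {N : ℕ} [NeZero N] (f : CuspForm (Gamma0 N) 2), IsNewformOf V f →
      ∀ ϖ : ℚ, (ϖ : ℝ) * V.realPeriodRat = plusPeriod f →
      ∃ n : ℕ, ‖PowerSeries.coeff n
        (PowerSeries.C (ϖ : ℚ_[p]) * padicLFunctionBranch f (unitRoot V p : ℚ_[p]) (p / 2))‖ = 1) :
    ChiBranchLowerDivisibilityAt W p := by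
  intro V _ _ κ γ N _ f hp4 hVW hV hκ hγ hγ' hf D ϖ hϖ g hgmem
  obtain ⟨C, hC⟩ := hVW
  obtain ⟨-, g₀, k, hchar, hι⟩ := hMC V hp4 ⟨C, hC⟩ hV hκ hγ hγ' hf D ϖ hϖ
  have hι' : iwasawaToPowerSeries p g₀ = PowerSeries.C ((p : ℚ_[p]) ^ k) *
      (PowerSeries.C (ϖ : ℚ_[p]) * padicLFunctionBranch f (unitRoot V p : ℚ_[p]) (p / 2)) := by
    rw [hι, map_mul, mul_assoc]
  have hk : 0 ≤ k :=
    X9.exponent_nonneg_of_exists_norm_coeff_eq_one g₀ _ k hι' (hcert V C hV hC f hf ϖ hϖ)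
  exact exists_iwasawaToPowerSeries_eq_mul_of_span_eq_of_nonneg D hchar hgmem hk hι

/-- **`p ≡ 3 (mod 4)` (`p = 3` included): the rational ODD branch main conjecture + ONE unit
coefficient ⟹ n1011-p07's INTEGRAL odd-branch containment `ChiBranchLowerDivisibilityOddAt W p`.**
[cite: BurungaleCastellaSkinner2025, Thm. 1.1.2 (a) (shape)] [cite: SkinnerUrban2014, Thm. 3.6.4 (p. 43) (shape)] -/
theorem chiBranchLowerDivisibilityOddAt_of_ratCharEqOdd_of_unitCoeff (W : WeierstrassCurve ℚ) (p : ℕ)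
    [Fact p.Prime] (hMC : ChiBranchRatCharEqOddAt W p)
    (hcert : ∀ (V : WeierstrassCurve ℚ) [V.IsElliptic] [V.IsGloballyMinimal] (C : VariableChange ℚ),
      GoodOrd V p → C • V.quadraticTwist (-(p : ℚ)) = W →
      ∀ {N : ℕ} [NeZero N] (f : CuspForm (Gamma0 N) 2), IsNewformOf V f →
      ∀ ϖ : ℚ, (ϖ : ℝ) * V.imaginaryPeriodRat = minusPeriod f →
      ∃ n : ℕ, ‖PowerSeries.coeff n
        (PowerSeries.C (ϖ : ℚ_[p]) * padicLFunctionMinusBranch f (unitRoot V p : ℚ_[p]) (p / 2))‖ = 1) :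
    ChiBranchLowerDivisibilityOddAt W p := by
  intro V _ _ κ γ N _ f hp4 hVW hV hκ hγ hγ' hf D ϖ hϖ g hgmem
  obtain ⟨C, hC⟩ := hVW
  obtain ⟨-, g₀, k, hchar, hι⟩ := hMC V hp4 ⟨C, hC⟩ hV hκ hγ hγ' hf D ϖ hϖ
  have hι' : iwasawaToPowerSeries p g₀ = PowerSeries.C ((p : ℚ_[p]) ^ k) *
      (PowerSeries.C (ϖ : ℚ_[p]) * padicLFunctionMinusBranch f (unitRoot V p : ℚ_[p]) (p / 2)) := by
    rw [hι, map_mul, mul_assoc]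
  have hk : 0 ≤ k :=
    X9.exponent_nonneg_of_exists_norm_coeff_eq_one g₀ _ k hι' (hcert V C hV hC f hf ϖ hϖ)
  exact exists_iwasawaToPowerSeries_eq_mul_of_span_eq_of_nonneg D hchar hgmem hk hι

/-- **The `T = 0` form on the potentially good rows, `p ≡ 1 (mod 4)`**: rational branch main conjecture
+ certificate ⟹ n1011-p07's `ChiBranchLowerLeadingTermAt W p` whenever `0 ≤ ord_p j(E)` (the
multiplicative-twist case of that predicate is vacuous there; p07's
`chiBranchLowerLeadingTermAt_of_divisibility_of_padicValRat_j_nonneg`).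
[cite: MazurTateTeitelbaum1986Invent, §I.14 (shape)] -/
theorem chiBranchLowerLeadingTermAt_of_ratCharEq_of_unitCoeff_of_padicValRat_j_nonneg
    (W : WeierstrassCurve ℚ) [W.IsElliptic] (p : ℕ) [Fact p.Prime] (hj : 0 ≤ padicValRat p W.j) (hMC : ChiBranchRatCharEqAt W p)
    (hcert : ∀ (V : WeierstrassCurve ℚ) [V.IsElliptic] [V.IsGloballyMinimal] (C : VariableChange ℚ),
      GoodOrd V p → C • V.quadraticTwist (p : ℚ) = W →
      ∀ {N : ℕ} [NeZero N] (f : CuspForm (Gamma0 N) 2), IsNewformOf V f →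
      ∀ ϖ : ℚ, (ϖ : ℝ) * V.realPeriodRat = plusPeriod f →
      ∃ n : ℕ, ‖PowerSeries.coeff n
        (PowerSeries.C (ϖ : ℚ_[p]) * padicLFunctionBranch f (unitRoot V p : ℚ_[p]) (p / 2))‖ = 1) :
    ChiBranchLowerLeadingTermAt W p :=
  chiBranchLowerLeadingTermAt_of_divisibility_of_padicValRat_j_nonneg p W hj
    (chiBranchLowerDivisibilityAt_of_ratCharEq_of_unitCoeff W p hMC hcert)

/-- **The `T = 0` form on the potentially good rows, `p ≡ 3 (mod 4)`** (p07's
`chiBranchLowerLeadingTermOddAt_of_divisibilityOdd_of_padicValRat_j_nonneg`).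
[cite: MazurTateTeitelbaum1986Invent, §I.14 (shape)] -/
theorem chiBranchLowerLeadingTermOddAt_of_ratCharEqOdd_of_unitCoeff_of_padicValRat_j_nonneg
    (W : WeierstrassCurve ℚ) [W.IsElliptic] (p : ℕ) [Fact p.Prime] (hj : 0 ≤ padicValRat p W.j) (hMC : ChiBranchRatCharEqOddAt W p)
    (hcert : ∀ (V : WeierstrassCurve ℚ) [V.IsElliptic] [V.IsGloballyMinimal] (C : VariableChange ℚ),
      GoodOrd V p → C • V.quadraticTwist (-(p : ℚ)) = W →
      ∀ {N : ℕ} [NeZero N] (f : CuspForm (Gamma0 N) 2), IsNewformOf V f →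
      ∀ ϖ : ℚ, (ϖ : ℝ) * V.imaginaryPeriodRat = minusPeriod f →
      ∃ n : ℕ, ‖PowerSeries.coeff n
        (PowerSeries.C (ϖ : ℚ_[p]) * padicLFunctionMinusBranch f (unitRoot V p : ℚ_[p]) (p / 2))‖ = 1) :
    ChiBranchLowerLeadingTermOddAt W p :=
  chiBranchLowerLeadingTermOddAt_of_divisibilityOdd_of_padicValRat_j_nonneg p W hj
    (chiBranchLowerDivisibilityOddAt_of_ratCharEqOdd_of_unitCoeff W p hMC hcert)

end Summit.BirchSwinnertonDyer.Rank1Residual.Additive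

end
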